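import Literature.NumberTheory.LFunctions.MontgomeryExplicitFormulaRightLine
import HarnessLib

/-!
# Montgomery's explicit formula: the integral over the line `re s = c`

Trunk T-ANT (`Literature/NumberTheory/LFunctions`), fourth support file for the discharge of the
named fact (P1) `Literature.NumberTheory.LFunctions.montgomery_explicit_formula` (Montgomery 1973,
Lemma; Goldston 2005, Proposition 1 (3.11)). Proofs only.

With `s₁ = −1/2+it`, `s₂ = 3/2+it`, `k(p) = 1/(p−s₁) − 1/(p−s₂)`, `r(s) = x^s k(s)` and the
contour folded onto the line `re s = c ∈ (1, 3/2)` (see `MontgomeryExplicitFormulaRightLine.lean`),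
the explicit formula is the evaluation of `∫ (ξ'/ξ)(s)[r(s) + r(1−s)] dy`. Here:

* `Montgomery.hasSum_trivialZeroTerm` — piece (4a): `∫ (1/s + Γ_ℝ'/Γ_ℝ + C)(s) r(s) dy
  = 2π(x^{s₁}(1/s₁ + Γ_ℝ'/Γ_ℝ(s₁) + C) − ∑_j k(−2(j+1))x^{−2(j+1)})`, stated as the convergence of
  the trivial-zero series (the `O(x^{−5/2}/ (|t|+2))`-term of Goldston's (3.11) after the factor
  `x^{−it}`), `C = (log π + γ)/2`;
* `Montgomery.integral_gammaFactor_mul_kernel_reflect` — piece (4b):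
  `∫ (1/s + Γ_ℝ'/Γ_ℝ + C)(s) r(1−s) dy = 2π x^{s₁}(1/(1−s₁) + Γ_ℝ'/Γ_ℝ(1−s₁) + C)`;
* `Montgomery.integral_kernel_add_kernel_reflect` — `∫ [r(s) + r(1−s)] dy = 4π x^{s₁}`;
* `Montgomery.logDeriv_riemannXi_vertical_eq`, `Montgomery.continuous_logDeriv_zeta_vertical`,
  `Montgomery.norm_logDeriv_zeta_vertical_le` — `ξ'/ξ = (1/s + Γ_ℝ'/Γ_ℝ) + 1/(s−1) + ζ'/ζ` on the
  line, with `ζ'/ζ` continuous and bounded there;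
* `Montgomery.integrable_logDeriv_riemannXi_mul_kernels` and
  `Montgomery.integral_logDeriv_riemannXi_mul_kernels` — **the value of the line integral**:
  `∫ (ξ'/ξ)(s)[r(s) + r(1−s)] dy = 2π { x^{s₁}(Γ_ℝ'/Γ_ℝ(s₁) + Γ_ℝ'/Γ_ℝ(1−s₁) − L(Λ, 3/2−it))
  + x k(1) − x^{it} A(x,t) − ∑_j k(−2(j+1)) x^{−2(j+1)} }`, `A(x,t) = montgomeryDirichletSum x t`,
  `x k(1) = 2x/((1/2+it)(3/2−it))`.

## References

* H. L. Montgomery, *The pair correlation of zeros of the zeta function*, Proc. Sympos. Pure Math.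
  24 (1973), 181–193, Lemma.
* D. A. Goldston, *Notes on pair correlation of zeros and prime numbers*, LMS Lecture Note Ser. 322
  (2005), Proposition 1, (3.11)–(3.14).
-/

noncomputable section

open Complex Filter Set MeasureTheory
open ArithmeticFunction hiding log id
open scoped Real Topology

namespace Literature.NumberTheory.LFunctions

namespace Montgomery

open Literature.Analysis.Complex

/-! ## (4a) The Gamma factor against `x^s k(s)`: residue at `s₁` and the trivial-zero series -/

/-- **The trivial-zero series.** For `x ≥ 1`, real `t`, `1 < c < 3/2`, `s₁ = −1/2+it`,
`s₂ = 3/2+it`, `k(p) = 1/(p−s₁) − 1/(p−s₂)`, `E(w) = 1/w + Γ_ℝ'/Γ_ℝ(w)`, `C = (log π + γ)/2`: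
the series `∑_{j≥0} k(−2(j+1)) x^{−2(j+1)}` converges, to
`x^{s₁}(E(s₁) + C) − (1/2π) ∫ (E(s) + C) x^s k(s) dy` (`s = c+iy`); i.e.
`∫ (E+C)(s) x^s k(s) dy = 2π (x^{s₁}(E(s₁)+C) − ∑_j k(−2(j+1)) x^{−2(j+1)})` — termwise
integration of the partial-fraction series of `E + C`, each term closed to the left past `s₁` and
the trivial zero `−2(j+1)`. [cite: Goldston2005, Proposition 1, (3.13)–(3.14)] -/
theorem hasSum_trivialZeroTerm {x : ℝ} (hx : 1 ≤ x) (t : ℝ) {c : ℝ} (hc1 : 1 < c)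
    (hc2 : c < 3 / 2) :
    HasSum (fun j : ℕ ↦ (1 / (-(2 * ((j : ℂ) + 1)) - (-1 / 2 + t * I)) -
        1 / (-(2 * ((j : ℂ) + 1)) - (3 / 2 + t * I))) * (x : ℂ) ^ (-(2 * ((j : ℂ) + 1))))
      ((x : ℂ) ^ (-1 / 2 + t * I) * (1 / (-1 / 2 + t * I) + logDeriv Gammaℝ (-1 / 2 + t * I) +
          ((Real.log π : ℂ) + (Real.eulerMascheroniConstant : ℂ)) / 2) -
        1 / (2 * π) * ∫ y : ℝ, (1 / ((c : ℂ) + y * I) + logDeriv Gammaℝ ((c : ℂ) + y * I) +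
            ((Real.log π : ℂ) + (Real.eulerMascheroniConstant : ℂ)) / 2) *
          ((x : ℂ) ^ ((c : ℂ) + y * I) *
            (1 / ((c : ℂ) + y * I - (-1 / 2 + t * I)) - 1 / ((c : ℂ) + y * I - (3 / 2 + t * I))))) := by
  have hx0 : 0 < x := one_pos.trans_le hx
  have hc0 : 0 < c := by linarith
  set s₁ : ℂ := -1 / 2 + t * I with hs₁
  set s₂ : ℂ := 3 / 2 + t * I with hs₂
  set C : ℂ := ((Real.log π : ℂ) + (Real.eulerMascheroniConstant : ℂ)) / 2 with hC
  have h1c : s₁.re < c := by rw [hs₁]; simp; linarith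
  have hc2' : c < s₂.re := by rw [hs₂]; simp; linarith
  have hs₁re : -2 < s₁.re := by rw [hs₁]; simp; norm_num
  have hs₁' : ∀ m : ℕ, s₁ / 2 ≠ -m := by
    intro m h
    have := congrArg re h
    rw [hs₁] at this
    simp at this
    have h4 : (4 : ℝ) * m = 1 := by linarith
    have h4' : (4 : ℕ) * m = 1 := by exact_mod_cast h4
    omega
  -- termwise integration of the series for `E + C`
  have hT := hasSum_integral_seriesTerm hx0 hc0 (p₁ := s₁) (p₂ := s₂) h1c.ne hc2'.ne'
  have hterm : ∀ j : ℕ, ∫ y : ℝ, (1 / (2 * ((j : ℂ) + 1)) -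
      1 / (((c : ℂ) + y * I) + 2 * ((j : ℂ) + 1))) *
      ((x : ℂ) ^ ((c : ℂ) + y * I) * (1 / ((c : ℂ) + y * I - s₁) - 1 / ((c : ℂ) + y * I - s₂))) =
      2 * π * ((x : ℂ) ^ s₁ * (1 / (2 * ((j : ℂ) + 1)) - 1 / (s₁ + 2 * ((j : ℂ) + 1))) -
        (1 / (-(2 * ((j : ℂ) + 1)) - s₁) - 1 / (-(2 * ((j : ℂ) + 1)) - s₂)) *
          (x : ℂ) ^ (-(2 * ((j : ℂ) + 1)))) :=
    fun j ↦ integral_seriesTerm_mul_kernel_of_one_le hx h1c hc2' hs₁re j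
  have hT' : HasSum (fun j : ℕ ↦ 2 * π * ((x : ℂ) ^ s₁ * (1 / (2 * ((j : ℂ) + 1)) -
      1 / (s₁ + 2 * ((j : ℂ) + 1))) -
        (1 / (-(2 * ((j : ℂ) + 1)) - s₁) - 1 / (-(2 * ((j : ℂ) + 1)) - s₂)) *
          (x : ℂ) ^ (-(2 * ((j : ℂ) + 1)))))
      (∫ y : ℝ, (1 / ((c : ℂ) + y * I) + logDeriv Gammaℝ ((c : ℂ) + y * I) + C) *
        ((x : ℂ) ^ ((c : ℂ) + y * I) *
          (1 / ((c : ℂ) + y * I - s₁) - 1 / ((c : ℂ) + y * I - s₂)))) :=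
    hT.congr_fun fun j ↦ (hterm j).symm
  -- the series at `s₁`
  have hG := (hasSum_inv_add_logDeriv_Gammaℝ hs₁re hs₁').mul_left (2 * π * (x : ℂ) ^ s₁)
  have hdiff := (hG.sub hT').div_const (2 * π)
  have h2π : (2 * π : ℂ) ≠ 0 := by simp [Real.pi_ne_zero]
  have key : HasSum (fun j : ℕ ↦ (1 / (-(2 * ((j : ℂ) + 1)) - s₁) -
      1 / (-(2 * ((j : ℂ) + 1)) - s₂)) * (x : ℂ) ^ (-(2 * ((j : ℂ) + 1))))
      ((2 * π * (x : ℂ) ^ s₁ * (1 / s₁ + logDeriv Gammaℝ s₁ + C) -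
        ∫ y : ℝ, (1 / ((c : ℂ) + y * I) + logDeriv Gammaℝ ((c : ℂ) + y * I) + C) *
          ((x : ℂ) ^ ((c : ℂ) + y * I) *
            (1 / ((c : ℂ) + y * I - s₁) - 1 / ((c : ℂ) + y * I - s₂)))) / (2 * π)) :=
    hdiff.congr_fun fun j ↦ by field_simp; ring
  have hval : ∀ J G : ℂ, (2 * π * (x : ℂ) ^ s₁ * G - J) / (2 * π) =
      (x : ℂ) ^ s₁ * G - 1 / (2 * π) * J := by
    intro J G
    field_simp
  rw [hval] at key
  exact key

/-! ## (4b) The Gamma factor against `x^{1−s} k(1−s)`: residue at `1 − s₁` -/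

/-- For `x ≥ 1`, real `t`, `1 < c < 3/2`:
`∫ (E+C)(s) x^{1−s} k(1−s) dy = 2π x^{s₁} (E(1−s₁) + C)` (`s = c+iy`; notation of
`hasSum_trivialZeroTerm`): `x^{1−s}k(1−s) = x (x⁻¹)^s (1/(s−(1−s₂)) − 1/(s−(1−s₁)))`, termwise
integration, each term closed to the right past `1 − s₁ = 3/2 − it` (no trivial-zero terms).
[cite: Goldston2005, Proposition 1, (3.13)–(3.14)] -/
theorem integral_gammaFactor_mul_kernel_reflect {x : ℝ} (hx : 1 ≤ x) (t : ℝ) {c : ℝ}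
    (hc1 : 1 < c) (hc2 : c < 3 / 2) :
    ∫ y : ℝ, (1 / ((c : ℂ) + y * I) + logDeriv Gammaℝ ((c : ℂ) + y * I) +
          ((Real.log π : ℂ) + (Real.eulerMascheroniConstant : ℂ)) / 2) *
        ((x : ℂ) ^ (1 - ((c : ℂ) + y * I)) *
          (1 / ((1 - ((c : ℂ) + y * I)) - (-1 / 2 + t * I)) -
            1 / ((1 - ((c : ℂ) + y * I)) - (3 / 2 + t * I)))) =
      2 * π * ((x : ℂ) ^ (-1 / 2 + t * I) * (1 / (1 - (-1 / 2 + t * I)) +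
        logDeriv Gammaℝ (1 - (-1 / 2 + t * I)) +
          ((Real.log π : ℂ) + (Real.eulerMascheroniConstant : ℂ)) / 2)) := by
  have hx0 : 0 < x := one_pos.trans_le hx
  have hxi : 0 < x⁻¹ := inv_pos.2 hx0
  have hxi1 : x⁻¹ ≤ 1 := inv_le_one_of_one_le₀ hx
  have hc0 : 0 < c := by linarith
  set s₁ : ℂ := -1 / 2 + t * I with hs₁
  set s₂ : ℂ := 3 / 2 + t * I with hs₂
  set C : ℂ := ((Real.log π : ℂ) + (Real.eulerMascheroniConstant : ℂ)) / 2 with hC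
  set a : ℂ := 1 - s₂ with ha_def
  set b : ℂ := 1 - s₁ with hb_def
  have hac : a.re < c := by rw [ha_def, hs₂]; simp; linarith
  have hcb : c < b.re := by rw [hb_def, hs₁]; simp; linarith
  have ha2 : -2 < a.re := by rw [ha_def, hs₂]; simp; norm_num
  have hb2 : -2 < b.re := by rw [hb_def, hs₁]; simp; norm_num
  have hb' : ∀ m : ℕ, b / 2 ≠ -m := by
    intro m h
    have := congrArg re h
    rw [hb_def, hs₁] at this
    simp at this
    linarith [(m.cast_nonneg : (0 : ℝ) ≤ m)]
  -- rewrite the integrand on the base `x⁻¹`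
  have hrw : ∀ y : ℝ, (1 / ((c : ℂ) + y * I) + logDeriv Gammaℝ ((c : ℂ) + y * I) + C) *
      ((x : ℂ) ^ (1 - ((c : ℂ) + y * I)) *
        (1 / ((1 - ((c : ℂ) + y * I)) - s₁) - 1 / ((1 - ((c : ℂ) + y * I)) - s₂))) =
      (x : ℂ) * ((1 / ((c : ℂ) + y * I) + logDeriv Gammaℝ ((c : ℂ) + y * I) + C) *
        ((((x⁻¹ : ℝ)) : ℂ) ^ ((c : ℂ) + y * I) *
          (1 / ((c : ℂ) + y * I - a) - 1 / ((c : ℂ) + y * I - b)))) := by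
    intro y
    rw [kernel_one_sub, cpow_one_sub_eq hx0]
    ring
  simp_rw [hrw]
  rw [MeasureTheory.integral_const_mul]
  -- termwise
  have hT := hasSum_integral_seriesTerm hxi hc0 (p₁ := a) (p₂ := b) hac.ne hcb.ne'
  have hterm : ∀ j : ℕ, ∫ y : ℝ, (1 / (2 * ((j : ℂ) + 1)) -
      1 / (((c : ℂ) + y * I) + 2 * ((j : ℂ) + 1))) *
      ((((x⁻¹ : ℝ)) : ℂ) ^ ((c : ℂ) + y * I) *
        (1 / ((c : ℂ) + y * I - a) - 1 / ((c : ℂ) + y * I - b))) =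
      2 * π * ((((x⁻¹ : ℝ)) : ℂ) ^ b * (1 / (2 * ((j : ℂ) + 1)) - 1 / (b + 2 * ((j : ℂ) + 1)))) :=
    fun j ↦ integral_seriesTerm_mul_kernel_of_le_one hxi hxi1 hac hcb ha2 j
  have hT' := hT.congr_fun fun j ↦ (hterm j).symm
  have hG := (hasSum_inv_add_logDeriv_Gammaℝ hb2 hb').mul_left (2 * π * (((x⁻¹ : ℝ)) : ℂ) ^ b)
  have hG' : HasSum (fun j : ℕ ↦ 2 * π * ((((x⁻¹ : ℝ)) : ℂ) ^ b *
      (1 / (2 * ((j : ℂ) + 1)) - 1 / (b + 2 * ((j : ℂ) + 1)))))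
      (2 * π * (((x⁻¹ : ℝ)) : ℂ) ^ b * (1 / b + logDeriv Gammaℝ b + C)) :=
    hG.congr_fun fun j ↦ by ring
  rw [hT'.unique hG']
  -- `x (x⁻¹)^b = x^{s₁}`
  have hx0' : (x : ℂ) ≠ 0 := ofReal_ne_zero.2 hx0.ne'
  have harg : (x : ℂ).arg ≠ π := by
    rw [arg_ofReal_of_nonneg hx0.le]; exact Real.pi_ne_zero.symm
  have e1 : ((x⁻¹ : ℝ) : ℂ) ^ b = (x : ℂ)⁻¹ * (x : ℂ) ^ s₁ := by
    rw [hb_def, ofReal_inv, inv_cpow _ _ harg, cpow_sub _ _ hx0', cpow_one]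
    field_simp
  rw [e1]
  field_simp

/-! ## (5) The kernels alone -/

/-- For `x ≥ 1`, real `t`, `1 < c < 3/2`: `∫ [x^s k(s) + x^{1−s} k(1−s)] dy = 4π x^{s₁}`
(`s = c + iy`; the first closes to the left past `s₁`, the second to the right past `1 − s₁`).
[folklore] -/
theorem integral_kernel_add_kernel_reflect {x : ℝ} (hx : 1 ≤ x) (t : ℝ) {c : ℝ} (hc1 : 1 < c)
    (hc2 : c < 3 / 2) :
    ∫ y : ℝ, ((x : ℂ) ^ ((c : ℂ) + y * I) *
        (1 / ((c : ℂ) + y * I - (-1 / 2 + t * I)) - 1 / ((c : ℂ) + y * I - (3 / 2 + t * I))) +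
      (x : ℂ) ^ (1 - ((c : ℂ) + y * I)) *
        (1 / ((1 - ((c : ℂ) + y * I)) - (-1 / 2 + t * I)) -
          1 / ((1 - ((c : ℂ) + y * I)) - (3 / 2 + t * I)))) =
      4 * π * (x : ℂ) ^ (-1 / 2 + t * I) := by
  have hx0 : 0 < x := one_pos.trans_le hx
  have hxi : 0 < x⁻¹ := inv_pos.2 hx0
  have hxi1 : x⁻¹ ≤ 1 := inv_le_one_of_one_le₀ hx
  set s₁ : ℂ := -1 / 2 + t * I with hs₁
  set s₂ : ℂ := 3 / 2 + t * I with hs₂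
  set a : ℂ := 1 - s₂ with ha_def
  set b : ℂ := 1 - s₁ with hb_def
  have h1c : s₁.re < c := by rw [hs₁]; simp; linarith
  have hc2' : c < s₂.re := by rw [hs₂]; simp; linarith
  have hac : a.re < c := by rw [ha_def, hs₂]; simp; linarith
  have hcb : c < b.re := by rw [hb_def, hs₁]; simp; linarith
  have hrw : ∀ y : ℝ, (x : ℂ) ^ (1 - ((c : ℂ) + y * I)) *
      (1 / ((1 - ((c : ℂ) + y * I)) - s₁) - 1 / ((1 - ((c : ℂ) + y * I)) - s₂)) =
      (x : ℂ) * ((((x⁻¹ : ℝ)) : ℂ) ^ ((c : ℂ) + y * I) *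
        (1 / ((c : ℂ) + y * I - a) - 1 / ((c : ℂ) + y * I - b))) := by
    intro y
    rw [kernel_one_sub, cpow_one_sub_eq hx0]
    ring
  simp_rw [hrw]
  rw [integral_add (integrable_cpow_mul_inv_sub_inv hx0 h1c.ne hc2'.ne')
      ((integrable_cpow_mul_inv_sub_inv hxi hac.ne hcb.ne').const_mul _),
    MeasureTheory.integral_const_mul, integral_cpow_mul_inv_sub_inv_of_one_le hx h1c hc2',
    integral_cpow_mul_inv_sub_inv_of_le_one hxi hxi1 hac hcb]
  have hx0' : (x : ℂ) ≠ 0 := ofReal_ne_zero.2 hx0.ne'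
  have harg : (x : ℂ).arg ≠ π := by
    rw [arg_ofReal_of_nonneg hx0.le]; exact Real.pi_ne_zero.symm
  have e1 : ((x⁻¹ : ℝ) : ℂ) ^ b = (x : ℂ)⁻¹ * (x : ℂ) ^ s₁ := by
    rw [hb_def, ofReal_inv, inv_cpow _ _ harg, cpow_sub _ _ hx0', cpow_one]
    field_simp
  rw [e1]
  field_simp
  ring

/-! ## `ξ'/ξ` on the line `re s = c > 1` -/

/-- On `re s = c > 1`: `ξ'/ξ(s) = (1/s + Γ_ℝ'/Γ_ℝ(s)) + 1/(s−1) + ζ'/ζ(s)`. [folklore] -/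
theorem logDeriv_riemannXi_vertical_eq {c : ℝ} (hc : 1 < c) (y : ℝ) :
    logDeriv riemannXi ((c : ℂ) + y * I) =
      (1 / ((c : ℂ) + y * I) + logDeriv Gammaℝ ((c : ℂ) + y * I)) + 1 / (((c : ℂ) + y * I) - 1) +
        deriv riemannZeta ((c : ℂ) + y * I) / riemannZeta ((c : ℂ) + y * I) := by
  set s : ℂ := (c : ℂ) + y * I with hs
  have hre : 1 < s.re := by simp [hs]; linarith
  rw [logDeriv_riemannXi_eq (by linarith) (riemannZeta₁_ne_zero_of_riemannXi hre.le).2,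
    logDeriv_riemannZeta₁_eq_of_one_lt_re hre,
    ArithmeticFunction.LSeries_vonMangoldt_eq_deriv_riemannZeta_div hre]
  ring

/-- On `re s = c > 1`: `|ζ'/ζ(c+iy)| ≤ ∑ Λ(n) n^{−c}`. [folklore] -/
theorem norm_logDeriv_zeta_vertical_le {c : ℝ} (hc : 1 < c) (y : ℝ) :
    ‖deriv riemannZeta ((c : ℂ) + y * I) / riemannZeta ((c : ℂ) + y * I)‖ ≤
      ∑' n : ℕ, ‖LSeries.term (fun n ↦ (Λ n : ℂ)) (c : ℂ) n‖ := by
  set s : ℂ := (c : ℂ) + y * I with hs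
  have hre : 1 < s.re := by simp [hs]; linarith
  have h := ArithmeticFunction.LSeries_vonMangoldt_eq_deriv_riemannZeta_div hre
  have e : deriv riemannZeta s / riemannZeta s = -LSeries (fun n ↦ (Λ n : ℂ)) s := by
    rw [h, neg_div, neg_neg]
  rw [e, norm_neg]
  have hsum : Summable fun n ↦ ‖LSeries.term (fun n ↦ (Λ n : ℂ)) s n‖ :=
    (ArithmeticFunction.LSeriesSummable_vonMangoldt hre).norm
  have heq : ∀ n, ‖LSeries.term (fun n ↦ (Λ n : ℂ)) s n‖ =
      ‖LSeries.term (fun n ↦ (Λ n : ℂ)) (c : ℂ) n‖ := by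
    intro n
    rw [LSeries.norm_term_eq, LSeries.norm_term_eq]
    simp [hs]
  calc ‖LSeries (fun n ↦ (Λ n : ℂ)) s‖ = ‖∑' n, LSeries.term (fun n ↦ (Λ n : ℂ)) s n‖ := rfl
    _ ≤ ∑' n, ‖LSeries.term (fun n ↦ (Λ n : ℂ)) s n‖ := norm_tsum_le_tsum_norm hsum
    _ = ∑' n, ‖LSeries.term (fun n ↦ (Λ n : ℂ)) (c : ℂ) n‖ := tsum_congr heq

/-- On `re s = c > 1`: `y ↦ ζ'/ζ(c+iy)` is continuous. [folklore] -/
theorem continuous_logDeriv_zeta_vertical {c : ℝ} (hc : 1 < c) :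
    Continuous fun y : ℝ ↦
      deriv riemannZeta ((c : ℂ) + y * I) / riemannZeta ((c : ℂ) + y * I) := by
  have h1 := continuous_logDeriv_riemannXi_vertical hc.le
  have h2 := continuous_inv_add_logDeriv_Gammaℝ_vertical (by linarith : 0 < c) 0
  have h3 := (continuous_inv_sub_one_vertical hc).1
  refine ((h1.sub h2).sub h3).congr fun y ↦ ?_
  simp only [Pi.sub_apply]
  rw [logDeriv_riemannXi_vertical_eq hc y]
  ring

/-! ## The integral over the line -/

/-- **Integrability on the line.** For `x ≥ 1`, real `t`, `1 < c < 3/2`, the function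
`y ↦ (ξ'/ξ)(s)·[x^s k(s) + x^{1−s} k(1−s)]` (`s = c+iy`) is integrable over `ℝ`
(`ξ'/ξ(c+iy) ≪ log(2+|y|)` and the bracket is `≪ x^c (1+|y−t|)^{−2}`). [folklore] -/
theorem integrable_logDeriv_riemannXi_mul_kernels {x : ℝ} (hx : 1 ≤ x) (t : ℝ) {c : ℝ}
    (hc1 : 1 < c) (hc2 : c < 3 / 2) :
    Integrable fun y : ℝ ↦ logDeriv riemannXi ((c : ℂ) + y * I) *
      ((x : ℂ) ^ ((c : ℂ) + y * I) *
          (1 / ((c : ℂ) + y * I - (-1 / 2 + t * I)) - 1 / ((c : ℂ) + y * I - (3 / 2 + t * I))) +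
        (x : ℂ) ^ (1 - ((c : ℂ) + y * I)) *
          (1 / ((1 - ((c : ℂ) + y * I)) - (-1 / 2 + t * I)) -
            1 / ((1 - ((c : ℂ) + y * I)) - (3 / 2 + t * I)))) := by
  have hx0 : 0 < x := one_pos.trans_le hx
  have hxi : 0 < x⁻¹ := inv_pos.2 hx0
  have hc0 : 0 < c := by linarith
  set s₁ : ℂ := -1 / 2 + t * I with hs₁
  set s₂ : ℂ := 3 / 2 + t * I with hs₂
  set a : ℂ := 1 - s₂ with ha_def
  set b : ℂ := 1 - s₁ with hb_def
  have h1c : s₁.re < c := by rw [hs₁]; simp; linarith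
  have hc2' : c < s₂.re := by rw [hs₂]; simp; linarith
  have hac : a.re < c := by rw [ha_def, hs₂]; simp; linarith
  have hcb : c < b.re := by rw [hb_def, hs₁]; simp; linarith
  -- the bracket is integrable
  have hrw : ∀ y : ℝ, (x : ℂ) ^ (1 - ((c : ℂ) + y * I)) *
      (1 / ((1 - ((c : ℂ) + y * I)) - s₁) - 1 / ((1 - ((c : ℂ) + y * I)) - s₂)) =
      (x : ℂ) * ((((x⁻¹ : ℝ)) : ℂ) ^ ((c : ℂ) + y * I) *
        (1 / ((c : ℂ) + y * I - a) - 1 / ((c : ℂ) + y * I - b))) := by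
    intro y
    rw [kernel_one_sub, cpow_one_sub_eq hx0]
    ring
  have hKK : Integrable fun y : ℝ ↦ (x : ℂ) ^ ((c : ℂ) + y * I) *
      (1 / ((c : ℂ) + y * I - s₁) - 1 / ((c : ℂ) + y * I - s₂)) +
      (x : ℂ) ^ (1 - ((c : ℂ) + y * I)) *
        (1 / ((1 - ((c : ℂ) + y * I)) - s₁) - 1 / ((1 - ((c : ℂ) + y * I)) - s₂)) := by
    simp_rw [hrw]
    exact (integrable_cpow_mul_inv_sub_inv hx0 h1c.ne hc2'.ne').add
      ((integrable_cpow_mul_inv_sub_inv hxi hac.ne hcb.ne').const_mul _)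
  -- `ξ'/ξ = (E + 0) + P + Z` with `E` of logarithmic growth and `P`, `Z` bounded
  obtain ⟨hPc, hPM⟩ := continuous_inv_sub_one_vertical hc1
  have hZc := continuous_logDeriv_zeta_vertical hc1
  have hZM := norm_logDeriv_zeta_vertical_le hc1
  have hE₁ : Integrable fun y : ℝ ↦ (1 / ((c : ℂ) + y * I) + logDeriv Gammaℝ ((c : ℂ) + y * I) + 0) *
      ((x : ℂ) ^ ((c : ℂ) + y * I) * (1 / ((c : ℂ) + y * I - s₁) - 1 / ((c : ℂ) + y * I - s₂))) :=
    integrable_gammaFactor_mul_kernel hc0 0 hx0 h1c.ne hc2'.ne'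
  have hE₂ : Integrable fun y : ℝ ↦ (1 / ((c : ℂ) + y * I) + logDeriv Gammaℝ ((c : ℂ) + y * I) + 0) *
      ((x : ℂ) ^ (1 - ((c : ℂ) + y * I)) *
        (1 / ((1 - ((c : ℂ) + y * I)) - s₁) - 1 / ((1 - ((c : ℂ) + y * I)) - s₂))) := by
    simp_rw [hrw]
    have h := (integrable_gammaFactor_mul_kernel hc0 0 hxi hac.ne hcb.ne').const_mul (x : ℂ)
    refine h.congr (ae_of_all _ fun y ↦ ?_)
    simp only
    ring
  have hPZ : Integrable fun y : ℝ ↦ (1 / (((c : ℂ) + y * I) - 1) +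
      deriv riemannZeta ((c : ℂ) + y * I) / riemannZeta ((c : ℂ) + y * I)) *
      ((x : ℂ) ^ ((c : ℂ) + y * I) * (1 / ((c : ℂ) + y * I - s₁) - 1 / ((c : ℂ) + y * I - s₂)) +
        (x : ℂ) ^ (1 - ((c : ℂ) + y * I)) *
          (1 / ((1 - ((c : ℂ) + y * I)) - s₁) - 1 / ((1 - ((c : ℂ) + y * I)) - s₂))) := by
    refine hKK.bdd_mul (c := 1 / (c - 1) + ∑' n : ℕ, ‖LSeries.term (fun n ↦ (Λ n : ℂ)) (c : ℂ) n‖)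
      (hPc.add hZc).aestronglyMeasurable (ae_of_all _ fun y ↦ ?_)
    exact (norm_add_le _ _).trans (add_le_add (hPM y) (hZM y))
  have h := (hE₁.add hE₂).add hPZ
  refine h.congr (ae_of_all _ fun y ↦ ?_)
  simp only [Pi.add_apply]
  rw [logDeriv_riemannXi_vertical_eq hc1 y]
  ring

/-- **The integral over the line `re s = c`.** For `x ≥ 1`, real `t`, `1 < c < 3/2`, with
`s₁ = −1/2+it`, `s₂ = 3/2+it`, `k(p) = 1/(p−s₁) − 1/(p−s₂)`, `A(x,t) = ∑ Λ(n)a_n(x)n^{−it}`: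
`∫ (ξ'/ξ)(s)[x^s k(s) + x^{1−s}k(1−s)] dy`
`= 2π { x^{s₁}(Γ_ℝ'/Γ_ℝ(s₁) + Γ_ℝ'/Γ_ℝ(1−s₁) − L(Λ, 3/2−it)) + x k(1) − x^{it}A(x,t)`
`        − ∑_j k(−2(j+1)) x^{−2(j+1)} }`
— the sum of the pieces `integral_neg_logDeriv_zeta_mul_kernel` (prime side),
`integral_logDeriv_zeta_mul_kernel_reflect`, `integral_inv_sub_one_mul_kernels` (main term
`x k(1) = 2x/((1/2+it)(3/2−it))`), `hasSum_trivialZeroTerm`, `integral_gammaFactor_mul_kernel_reflect`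
and `integral_kernel_add_kernel_reflect`. [cite: Goldston2005, Proposition 1, (3.11)–(3.14)] -/
theorem integral_logDeriv_riemannXi_mul_kernels {x : ℝ} (hx : 1 ≤ x) (t : ℝ) {c : ℝ}
    (hc1 : 1 < c) (hc2 : c < 3 / 2) :
    ∫ y : ℝ, logDeriv riemannXi ((c : ℂ) + y * I) *
      ((x : ℂ) ^ ((c : ℂ) + y * I) *
          (1 / ((c : ℂ) + y * I - (-1 / 2 + t * I)) - 1 / ((c : ℂ) + y * I - (3 / 2 + t * I))) +
        (x : ℂ) ^ (1 - ((c : ℂ) + y * I)) *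
          (1 / ((1 - ((c : ℂ) + y * I)) - (-1 / 2 + t * I)) -
            1 / ((1 - ((c : ℂ) + y * I)) - (3 / 2 + t * I)))) =
      2 * π * ((x : ℂ) ^ (-1 / 2 + t * I) *
          (logDeriv Gammaℝ (-1 / 2 + t * I) + logDeriv Gammaℝ (1 - (-1 / 2 + t * I)) -
            LSeries (fun n ↦ (Λ n : ℂ)) (3 / 2 - t * I)) +
        x * (1 / (1 - (-1 / 2 + t * I)) - 1 / (1 - (3 / 2 + t * I))) -
        (x : ℂ) ^ ((t : ℂ) * I) * montgomeryDirichletSum x t -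
        ∑' j : ℕ, (1 / (-(2 * ((j : ℂ) + 1)) - (-1 / 2 + t * I)) -
          1 / (-(2 * ((j : ℂ) + 1)) - (3 / 2 + t * I))) * (x : ℂ) ^ (-(2 * ((j : ℂ) + 1)))) := by
  have hx0 : 0 < x := one_pos.trans_le hx
  have hxi : 0 < x⁻¹ := inv_pos.2 hx0
  have hc0 : 0 < c := by linarith
  -- the values of the pieces (before introducing abbreviations)
  have hR := (hasSum_trivialZeroTerm hx t hc1 hc2).tsum_eq
  have h4b := integral_gammaFactor_mul_kernel_reflect hx t hc1 hc2
  have h5 := integral_kernel_add_kernel_reflect hx t hc1 hc2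
  have h3 := integral_inv_sub_one_mul_kernels hx t hc1 hc2
  have h1 := integral_neg_logDeriv_zeta_mul_kernel hx0 t hc1 hc2
  have h2 := integral_logDeriv_zeta_mul_kernel_reflect hx t hc1 hc2
  rw [hR]
  set s₁ : ℂ := -1 / 2 + t * I with hs₁
  set s₂ : ℂ := 3 / 2 + t * I with hs₂
  set C : ℂ := ((Real.log π : ℂ) + (Real.eulerMascheroniConstant : ℂ)) / 2 with hC
  set a : ℂ := 1 - s₂ with ha_def
  set b : ℂ := 1 - s₁ with hb_def
  have h1c : s₁.re < c := by rw [hs₁]; simp; linarith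
  have hc2' : c < s₂.re := by rw [hs₂]; simp; linarith
  have hac : a.re < c := by rw [ha_def, hs₂]; simp; linarith
  have hcb : c < b.re := by rw [hb_def, hs₁]; simp; linarith
  -- abbreviations for the pieces of the integrand
  obtain ⟨K, hK⟩ : ∃ f : ℝ → ℂ, f = fun y : ℝ ↦ (x : ℂ) ^ ((c : ℂ) + y * I) *
      (1 / ((c : ℂ) + y * I - s₁) - 1 / ((c : ℂ) + y * I - s₂)) := ⟨_, rfl⟩
  obtain ⟨Kt, hKt⟩ : ∃ f : ℝ → ℂ, f = fun y : ℝ ↦ (x : ℂ) ^ (1 - ((c : ℂ) + y * I)) *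
      (1 / ((1 - ((c : ℂ) + y * I)) - s₁) - 1 / ((1 - ((c : ℂ) + y * I)) - s₂)) := ⟨_, rfl⟩
  obtain ⟨E, hE⟩ : ∃ f : ℝ → ℂ, f = fun y : ℝ ↦
      1 / ((c : ℂ) + y * I) + logDeriv Gammaℝ ((c : ℂ) + y * I) + C := ⟨_, rfl⟩
  obtain ⟨P, hP⟩ : ∃ f : ℝ → ℂ, f = fun y : ℝ ↦ 1 / (((c : ℂ) + y * I) - 1) := ⟨_, rfl⟩
  obtain ⟨Z, hZ⟩ : ∃ f : ℝ → ℂ, f = fun y : ℝ ↦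
      deriv riemannZeta ((c : ℂ) + y * I) / riemannZeta ((c : ℂ) + y * I) := ⟨_, rfl⟩
  -- the reflected kernel on the base `x⁻¹`
  have hrw : ∀ y : ℝ, Kt y = (x : ℂ) * ((((x⁻¹ : ℝ)) : ℂ) ^ ((c : ℂ) + y * I) *
      (1 / ((c : ℂ) + y * I - a) - 1 / ((c : ℂ) + y * I - b))) := by
    intro y
    rw [hKt]
    dsimp only
    rw [kernel_one_sub, cpow_one_sub_eq hx0]
    ring
  -- integrability of the pieces
  have iK : Integrable K := by rw [hK]; exact integrable_cpow_mul_inv_sub_inv hx0 h1c.ne hc2'.ne'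
  have iKt : Integrable Kt := by
    rw [funext hrw]
    exact (integrable_cpow_mul_inv_sub_inv hxi hac.ne hcb.ne').const_mul _
  have iEK : Integrable fun y ↦ E y * K y := by
    rw [hE, hK]; exact integrable_gammaFactor_mul_kernel hc0 C hx0 h1c.ne hc2'.ne'
  have iEKt : Integrable fun y ↦ E y * Kt y := by
    simp_rw [hrw]
    rw [hE]
    have h := (integrable_gammaFactor_mul_kernel hc0 C hxi hac.ne hcb.ne').const_mul (x : ℂ)
    refine h.congr (ae_of_all _ fun y ↦ ?_)
    simp only
    ring
  obtain ⟨hPc, hPM⟩ := continuous_inv_sub_one_vertical hc1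
  have hZc := continuous_logDeriv_zeta_vertical hc1
  have hZM := norm_logDeriv_zeta_vertical_le hc1
  have iPKK : Integrable fun y ↦ P y * (K y + Kt y) := by
    rw [hP]
    exact (iK.add iKt).bdd_mul hPc.aestronglyMeasurable (ae_of_all _ hPM)
  have iZK : Integrable fun y ↦ Z y * K y := by
    rw [hZ]
    exact iK.bdd_mul hZc.aestronglyMeasurable (ae_of_all _ hZM)
  have iZKt : Integrable fun y ↦ Z y * Kt y := by
    rw [hZ]
    exact iKt.bdd_mul hZc.aestronglyMeasurable (ae_of_all _ hZM)
  -- the decomposition of the integrand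
  have hsplit : ∀ y : ℝ, logDeriv riemannXi ((c : ℂ) + y * I) * (K y + Kt y) =
      (E y * K y + E y * Kt y) + ((P y * (K y + Kt y) - C * (K y + Kt y)) +
        (Z y * K y + Z y * Kt y)) := by
    intro y
    rw [logDeriv_riemannXi_vertical_eq hc1 y, hE, hP, hZ]
    ring
  have iA : Integrable fun y ↦ E y * K y + E y * Kt y := iEK.add iEKt
  have iKK : Integrable fun y ↦ K y + Kt y := iK.add iKt
  have iCKK : Integrable fun y ↦ C * (K y + Kt y) := iKK.const_mul C
  have iB₁ : Integrable fun y ↦ P y * (K y + Kt y) - C * (K y + Kt y) := iPKK.sub iCKK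
  have iB₂ : Integrable fun y ↦ Z y * K y + Z y * Kt y := iZK.add iZKt
  have iB : Integrable fun y ↦ (P y * (K y + Kt y) - C * (K y + Kt y)) +
      (Z y * K y + Z y * Kt y) := iB₁.add iB₂
  have hgoal : (∫ y : ℝ, logDeriv riemannXi ((c : ℂ) + y * I) * (K y + Kt y)) =
      ((∫ y, E y * K y) + ∫ y, E y * Kt y) + (((∫ y, P y * (K y + Kt y)) - C * ∫ y, (K y + Kt y)) +
        ((∫ y, Z y * K y) + ∫ y, Z y * Kt y)) := by
    simp_rw [hsplit]
    rw [integral_add iA iB, integral_add iEK iEKt, integral_add iB₁ iB₂, integral_sub iPKK iCKK,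
      integral_add iZK iZKt, MeasureTheory.integral_const_mul]
  -- assemble
  have eK : ∀ y : ℝ, (x : ℂ) ^ ((c : ℂ) + y * I) *
      (1 / ((c : ℂ) + y * I - s₁) - 1 / ((c : ℂ) + y * I - s₂)) = K y := by
    intro y; rw [hK]
  have eKt : ∀ y : ℝ, (x : ℂ) ^ (1 - ((c : ℂ) + y * I)) *
      (1 / ((1 - ((c : ℂ) + y * I)) - s₁) - 1 / ((1 - ((c : ℂ) + y * I)) - s₂)) = Kt y := by
    intro y; rw [hKt]
  have eE : ∀ y : ℝ, 1 / ((c : ℂ) + y * I) + logDeriv Gammaℝ ((c : ℂ) + y * I) + C = E y := by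
    intro y; rw [hE]
  have eP : ∀ y : ℝ, 1 / (((c : ℂ) + y * I) - 1) = P y := by
    intro y; rw [hP]
  have eZ : ∀ y : ℝ, deriv riemannZeta ((c : ℂ) + y * I) / riemannZeta ((c : ℂ) + y * I) = Z y := by
    intro y; rw [hZ]
  simp only [neg_div, neg_mul, integral_neg] at h1
  simp only [eK, eKt, eE, eP, eZ] at h4b h5 h3 h1 h2 ⊢
  have h1' : ∫ y, Z y * K y = -(2 * π * ((x : ℂ) ^ ((t : ℂ) * I) * montgomeryDirichletSum x t)) := by
    rw [← h1, neg_neg]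
  rw [hgoal, h4b, h5, h3, h1', h2]
  have h2π : (2 * π : ℂ) ≠ 0 := by simp [Real.pi_ne_zero]
  have hs10 : s₁ ≠ 0 := by
    rw [hs₁]; intro h; have := congrArg re h; norm_num at this
  have hs11 : s₁ - 1 ≠ 0 := by
    rw [hs₁]; intro h; have := congrArg re h; norm_num at this
  have ha0 : a ≠ 0 := by
    rw [ha_def, hs₂]; intro h; have := congrArg re h; norm_num at this
  have e1 : 1 / b = -(1 / (s₁ - 1)) := by
    rw [hb_def, ← neg_sub, one_div_neg_eq_neg_one_div]
  rw [e1]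
  field_simp
  ring

end Montgomery

end Literature.NumberTheory.LFunctions
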